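import Summits.HubbardSuperconductivity.HubbardSuperconductivity.Theses.ParityLeeYang
import Literature.MathematicalPhysics.QuantumLattice.FreeFermionTwistedTraceFormula

/-!
# Route `ParityLeeYang`, support `FreeParityDet` (item stmt-HubbardSuperconductivity-8385)

T1: at `U = 0` the parity-twisted Gaussian trace is a determinant,
`Tr[(-1)^N · e^{−β (H(t,0) − μN)}] = det(1 − e^{−βh})`, `h = hubbardOneBody G t μ`.
The free Hubbard Hamiltonian is the second quantisation `dΓ(h)` (`hamiltonianWith_zero_eq_dGamma`,
proved in `FermionQuasiFree.lean`) and the parity-twisted free-fermion trace formula is the tree's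
`trace_parityOp_mul_gibbsWeight_dGamma` (`FreeFermionTwistedTraceFormula.lean`, the case `c = iπ`
of the `U(1)`-twisted formula). Dereziński–Gérard, *Mathematics of Quantization and Quantum
Fields*, §17.2 (`Tr Γ(γ) = det(1 + γ)`, here with `γ = −e^{−βh}`). [folklore]
-/

-- the mandated namespace `Summit.<Summit>.<Problem>.Theorems` repeats `HubbardSuperconductivity`
-- (single-problem summit, D-0017), which the `dupNamespace` linter flags on every declaration
set_option linter.dupNamespace false

namespace Summit.HubbardSuperconductivity.HubbardSuperconductivity.Theorems.ParityLeeYang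

open Matrix Literature.MathematicalPhysics.QuantumLattice

/-- **`FreeParityDet`** (route `ParityLeeYang`, item stmt-HubbardSuperconductivity-8385): on every
finite graph, `Tr[parityOp · e^{−β(H(t,0) − μN)}] = det(1 − e^{−β·hubbardOneBody G t μ})`.
[cite: DerezinskiGerard2022, §17.2 (Density matrix, display before Def. 17.36)] -/
theorem freeParityDet_proof :
    Summit.HubbardSuperconductivity.HubbardSuperconductivity.Theses.ParityLeeYang.FreeParityDet := by
  intro Λ _ _ G _ t μ β
  rw [hamiltonianWith_zero_eq_dGamma,
    trace_parityOp_mul_gibbsWeight_dGamma (isHermitian_hubbardOneBody G t μ) β]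
  rfl

end Summit.HubbardSuperconductivity.HubbardSuperconductivity.Theorems.ParityLeeYang
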